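/-
Copyright (c) 2026 the pub-hodgecm-mathlib formalisation cell (harness21).  Prover seat hodgecm-mathlib-R90-CS-p03 (g2), R90-TF section S8 «ContSpec-n½» (dealer R90-CS-plan (g3),
S8-R136 (4) «`hA32` BY DEFAULT YOURS after (a-3) — non-vanishing at `z = 3∕2` is by CHOICE of the bad-place local sections: big-cell-supported test sections make the local mean a
volume, constant in `z`»; file (a-4), FINITE half of ★ F5's `hA32`): TEST WEIGHTS at the bad places — their χ-local means are `z`-free non-zero constants.
-/
import Summits.HodgeConjecture.HodgeConjecture.Theorems.K2E1ChiIntertwiningLocalFactorHolomorphicU3   -- ★ (a-3) (this seat): brings ★ `continuous_localHeight`, the local height currency, `integralBox`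
import Literature.NumberTheory.Automorphic.AddCharConductorExponent                               -- ★ `exists_normAbs_eq_inv_zpow` (`‖x‖ ∈ q^ℤ`)
import HarnessLib

/-!
# K2·E1 ∕ R90·S8 — `K2E1ChiLocalMeanTestWeightU3` (file (a-4)): BAD-PLACE TEST WEIGHTS — ON THE UNIT-HEIGHT BALL `B_v = {Q_v = 1} ∩ 𝒪_v³` (open, `∋ 0`, positive finite volume) A
# WEIGHT `ω_v = c·𝟙_{B_v}` HAS χ-LOCAL MEAN `m_v(z) = c·ν_v³(B_v)∕ν_v³(𝒪_v³)` FOR EVERY `z` — IN PARTICULAR `m_v(3∕2) ≠ 0` (the finite half of ★ F5's letter `hA32`)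

Cell `pub/hodgecm-mathlib`, crux h413 = `stmt-HodgeConjecture-24833`, route of record `HCCMUnconditional`; R90-TF section S8 «ContSpec-n½», road R2-χ₃ (the (V) scalar road; ★ F5's
binder `hA32 : A (3∕2) ≠ 0` for the ★ (a-2b) amplitude `A z = C·(∫∫ ω_∞·ARCH₃^{−z})·∏_{v∈S₀} m_v(z)`).  THEOREMS ONLY (no `def`, no `instance`, no notation, no named-fact hypothesis,
no `sorry`; default heartbeats); lane `--supports stmt-HodgeConjecture-24833 --as helper` (count-neutral).  Closes no socket.

THE MATHEMATICS ([MoeglinWaldspurger1995] II.1.6, IV.1.11; [Rogawski1990] §4.5; [TateThesis1967] §3.3).  At a bad place `v ∈ S₀` the local section of the Eisenstein datum is at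
our disposal (dealer S8-R136 (4)); a section supported on the big cell `ι(w₀)·N(𝒪)`-close to `ι(w₀)` reads, in the base coordinates `p ∈ (L⁺_v)³` of ★ (a-1), as a weight
`ω_v = c·𝟙_{B_v}` on an open ball `B_v ∋ 0` on which the local height `Q_v` is `1`; then `ω_v·Q_v^{−z} = c·𝟙_{B_v}` for EVERY `z`, so the χ-local mean `m_v(z) = ν_v³(𝒪_v³)⁻¹ • ∫ ω_v·Q_v^{−z}`
is the `z`-FREE constant `c·ν_v³(B_v)∕ν_v³(𝒪_v³)`, non-zero for `c ≠ 0`.  The ball: `B_v := Q_v⁻¹(−∞, 2) ∩ 𝒪_v³` — the non-archimedean norms take values in `q^ℤ ∪ {0}`, so a height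
factor `> 1` is `≥ 2` (§1 `two_le_normAbs_of_one_lt`) and `Q_v < 2 ⟺ Q_v = 1` (§1 `localHeight_eq_one_of_lt_two`); `Q_v` is continuous (★ `continuous_localHeight`) and `Q_v(0) = 1`, `𝒪_v³` is
clopen and compact (★), so `B_v` is open, contains `0`, and has positive finite Haar volume.  NO arithmetic hypothesis on `v` (ramified, `v ∣ 2`, `δ` non-unit alike).
* §1 `two_le_normAbs_of_one_lt`, `localHeight_eq_one_of_lt_two`, `localHeight_zero`, **`exists_testBall`** (`∃ B`, open, `0 ∈ B ⊆ 𝒪_v³`, `Q_v = 1` on `B`, `0 < ν_v³ B < ⊤`).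
* §2 **`chiLocalMean_eq_of_testWeight`** — for ANY measurable `B` with `Q_v = 1` on `B` and a weight `= c` on `B`, `= 0` off `B`: `m_v(z) = ((ν_v³ B).toReal ∕ (ν_v³ 𝒪_v³).toReal) • c` for every
  `z` (★ (a-1)'s `m_v(z)` bytes); **`chiLocalMean_ne_zero_of_testWeight`** (`c ≠ 0`, `0 < ν_v³ B < ⊤`); `aestronglyMeasurable_testWeight`, `norm_testWeight_le` (the hypotheses of ★ (a-3)
  `differentiableOn_chiLocalMean_three` for these weights, `‖c‖ ≤ 1`).
HONEST SCOPE.  NOT here: that the (V) assembly's bad-place sections CAN be so chosen inside ★ `chiSectionSpacePair` (the section-side statement «the Iwasawa weight of the test section is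
`c·𝟙_{B_v}`» is the assembly's ∕ the section-factorisation letter's business), nor the ARCHIMEDEAN half of `hA32` (the explicit Beta∕Γ value of `∫∫ ω_∞·ARCH₃^{−3∕2}` for the archimedean
weight of record — K2E2-p12's choice).
HONEST LABEL: HC_CM is proved only modulo the 7 printed citations (2 remaining named inputs: hLiu418 = `stmt-HodgeConjecture-24832`, h413 = `stmt-HodgeConjecture-24833`) until rung 0
closes; REL ≠ ★ ≠ BUILT; this file asserts no named fact and closes no socket; count-neutral; unconditional local analysis.

## References
* [MoeglinWaldspurger1995] C. Mœglin, J.-L. Waldspurger, *Spectral Decomposition and Eisenstein Series* (1995): II.1.6, IV.1.11.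
* [Rogawski1990] J. D. Rogawski, *Automorphic Representations of Unitary Groups in Three Variables*, Ann. of Math. Stud. 123 (1990): §4.5.
* [TateThesis1967] J. Tate, *Fourier analysis in number fields and Hecke's zeta-functions* (1967): §3.3.
* [CasselsFrohlichANT1967] J. W. S. Cassels, A. Fröhlich (eds.), *Algebraic Number Theory* (1967): Ch. II §7.
-/

set_option autoImplicit false
set_option linter.dupNamespace false -- the mandated namespace repeats `HodgeConjecture.HodgeConjecture`

noncomputable section

open MeasureTheory MeasureTheory.Measure NumberField IsDedekindDomain Filter Set
open scoped NNReal ENNReal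
open Literature.NumberTheory.Automorphic Literature.NumberTheory.Automorphic.UnitaryGroup Literature.NumberTheory.GaloisRepresentations
open Literature.NumberTheory.GaloisRepresentations.IsNonarchimedeanLocalField
open Summit.HodgeConjecture.HodgeConjecture.Cruxes.H413
open Summit.HodgeConjecture.HodgeConjecture.Cruxes.H413.K2E1WhittakerCoefficientEulerProductU3B (continuous_localHeight)

namespace Summit.HodgeConjecture.HodgeConjecture.Cruxes.H413.K2E1ChiLocalMeanTestWeightU3

/-! ## §1 The unit-height test ball -/

section Gap

variable {F : Type*} [Field F] [ValuativeRel F] [TopologicalSpace F] [IsNonarchimedeanLocalField F]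

/-- **The gap above `1`**: a non-archimedean absolute value `> 1` is `≥ 2` (`‖x‖ ∈ q^ℤ`, `q ≥ 2`; ★ `exists_normAbs_eq_inv_zpow`). [cite: CasselsFrohlichANT1967, Ch. II §7] -/
theorem two_le_normAbs_of_one_lt {x : F} (hx : 1 < ((normAbs F x : ℝ≥0) : ℝ)) : (2 : ℝ) ≤ ((normAbs F x : ℝ≥0) : ℝ) := by
  have hx0 : x ≠ 0 := by
    rintro rfl
    rw [map_zero, NNReal.coe_zero] at hx
    exact absurd hx (by norm_num)
  obtain ⟨k, hk⟩ := exists_normAbs_eq_inv_zpow hx0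
  have hq : (2 : ℝ) ≤ (residueFieldCard F : ℝ) := by exact_mod_cast (one_lt_residueFieldCard (F := F))
  have hq1 : (1 : ℝ) ≤ (residueFieldCard F : ℝ) := le_trans one_le_two hq
  have hk' : ((normAbs F x : ℝ≥0) : ℝ) = (residueFieldCard F : ℝ) ^ (-k) := by
    rw [hk, NNReal.coe_zpow, NNReal.coe_inv, NNReal.coe_natCast, inv_zpow']
  rw [hk'] at hx ⊢
  have hk1 : 1 ≤ -k := by
    by_contra h
    push Not at h
    have : (residueFieldCard F : ℝ) ^ (-k) ≤ 1 := zpow_le_one_of_nonpos₀ hq1 (by omega)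
    linarith
  calc (2 : ℝ) ≤ (residueFieldCard F : ℝ) := hq
    _ = (residueFieldCard F : ℝ) ^ (1 : ℤ) := (zpow_one _).symm
    _ ≤ (residueFieldCard F : ℝ) ^ (-k) := zpow_le_zpow_right₀ hq1 hk1

end Gap

variable (L : Type) [Field L] [NumberField L] [IsCMField L] {δ : L} (hcδ : IsCMField.complexConj L δ = -δ) (hδ : δ ≠ 0)
  (v : HeightOneSpectrum (𝓞 ↥(maximalRealSubfield L)))

/-- **`Q_v(p) < 2 ⟹ Q_v(p) = 1`**: every factor `max(1, ‖X_{w'}‖, ‖Z_{w'}‖)` of the local height is `1` or `≥ 2` (§1 gap), and the factors are `≥ 1`. [cite: CasselsFrohlichANT1967, Ch. II §7] -/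
theorem localHeight_eq_one_of_lt_two (p : Fin 3 → v.adicCompletion ↥(maximalRealSubfield L))
    (hp : (∏ w' : PlacesOver L v, max 1 (max ((normAbs (w'.1.adicCompletion L) (quadraticLocalEquiv L v (IsCMField.complexConj L) hcδ hδ (p 0, p 1) w') : ℝ≥0) : ℝ)
            ((normAbs (w'.1.adicCompletion L) ((toLocalRing L v (p 2) * algebraMap L (LocalRing L v) δ -
              toLocalRing L v 2⁻¹ * (quadraticLocalEquiv L v (IsCMField.complexConj L) hcδ hδ (p 0, p 1) *
                conjLocal L (IsCMField.complexConj L) v (quadraticLocalEquiv L v (IsCMField.complexConj L) hcδ hδ (p 0, p 1)))) w') : ℝ≥0) : ℝ))) < 2) :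
    (∏ w' : PlacesOver L v, max 1 (max ((normAbs (w'.1.adicCompletion L) (quadraticLocalEquiv L v (IsCMField.complexConj L) hcδ hδ (p 0, p 1) w') : ℝ≥0) : ℝ)
            ((normAbs (w'.1.adicCompletion L) ((toLocalRing L v (p 2) * algebraMap L (LocalRing L v) δ -
              toLocalRing L v 2⁻¹ * (quadraticLocalEquiv L v (IsCMField.complexConj L) hcδ hδ (p 0, p 1) *
                conjLocal L (IsCMField.complexConj L) v (quadraticLocalEquiv L v (IsCMField.complexConj L) hcδ hδ (p 0, p 1)))) w') : ℝ≥0) : ℝ))) = 1 := by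
  refine Finset.prod_eq_one fun w' _ => ?_
  -- the `w'`-factor is `≤ Q_v < 2`
  have hle : max 1 (max ((normAbs (w'.1.adicCompletion L) (quadraticLocalEquiv L v (IsCMField.complexConj L) hcδ hδ (p 0, p 1) w') : ℝ≥0) : ℝ)
            ((normAbs (w'.1.adicCompletion L) ((toLocalRing L v (p 2) * algebraMap L (LocalRing L v) δ -
              toLocalRing L v 2⁻¹ * (quadraticLocalEquiv L v (IsCMField.complexConj L) hcδ hδ (p 0, p 1) *
                conjLocal L (IsCMField.complexConj L) v (quadraticLocalEquiv L v (IsCMField.complexConj L) hcδ hδ (p 0, p 1)))) w') : ℝ≥0) : ℝ)) ≤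
      (∏ w' : PlacesOver L v, max 1 (max ((normAbs (w'.1.adicCompletion L) (quadraticLocalEquiv L v (IsCMField.complexConj L) hcδ hδ (p 0, p 1) w') : ℝ≥0) : ℝ)
            ((normAbs (w'.1.adicCompletion L) ((toLocalRing L v (p 2) * algebraMap L (LocalRing L v) δ -
              toLocalRing L v 2⁻¹ * (quadraticLocalEquiv L v (IsCMField.complexConj L) hcδ hδ (p 0, p 1) *
                conjLocal L (IsCMField.complexConj L) v (quadraticLocalEquiv L v (IsCMField.complexConj L) hcδ hδ (p 0, p 1)))) w') : ℝ≥0) : ℝ))) := by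
    classical
    rw [← Finset.mul_prod_erase _ _ (Finset.mem_univ w')]
    exact le_mul_of_one_le_right (le_trans zero_le_one (le_max_left _ _)) (Finset.one_le_prod fun _ _ => le_max_left _ _)
  have hlt := lt_of_le_of_lt hle hp
  refine max_eq_left (max_le ?_ ?_)
  · by_contra h
    push Not at h
    have h2 := two_le_normAbs_of_one_lt h
    have : (2 : ℝ) ≤ max 1 (max ((normAbs (w'.1.adicCompletion L) (quadraticLocalEquiv L v (IsCMField.complexConj L) hcδ hδ (p 0, p 1) w') : ℝ≥0) : ℝ)
            ((normAbs (w'.1.adicCompletion L) ((toLocalRing L v (p 2) * algebraMap L (LocalRing L v) δ -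
              toLocalRing L v 2⁻¹ * (quadraticLocalEquiv L v (IsCMField.complexConj L) hcδ hδ (p 0, p 1) *
                conjLocal L (IsCMField.complexConj L) v (quadraticLocalEquiv L v (IsCMField.complexConj L) hcδ hδ (p 0, p 1)))) w') : ℝ≥0) : ℝ)) :=
      le_trans h2 (le_trans (le_max_left _ _) (le_max_right _ _))
    linarith
  · by_contra h
    push Not at h
    have h2 := two_le_normAbs_of_one_lt h
    have : (2 : ℝ) ≤ max 1 (max ((normAbs (w'.1.adicCompletion L) (quadraticLocalEquiv L v (IsCMField.complexConj L) hcδ hδ (p 0, p 1) w') : ℝ≥0) : ℝ)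
            ((normAbs (w'.1.adicCompletion L) ((toLocalRing L v (p 2) * algebraMap L (LocalRing L v) δ -
              toLocalRing L v 2⁻¹ * (quadraticLocalEquiv L v (IsCMField.complexConj L) hcδ hδ (p 0, p 1) *
                conjLocal L (IsCMField.complexConj L) v (quadraticLocalEquiv L v (IsCMField.complexConj L) hcδ hδ (p 0, p 1)))) w') : ℝ≥0) : ℝ)) :=
      le_trans h2 (le_trans (le_max_right _ _) (le_max_right _ _))
    linarith

/-- **`Q_v(0) = 1`** (`X = Ψ_v(0,0) = 0`, `Z = ι(0)·δ − ½·0·σ0 = 0`). [folklore] -/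
theorem localHeight_zero :
    (fun p : Fin 3 → v.adicCompletion ↥(maximalRealSubfield L) => (∏ w' : PlacesOver L v, max 1 (max ((normAbs (w'.1.adicCompletion L) (quadraticLocalEquiv L v (IsCMField.complexConj L) hcδ hδ (p 0, p 1) w') : ℝ≥0) : ℝ)
            ((normAbs (w'.1.adicCompletion L) ((toLocalRing L v (p 2) * algebraMap L (LocalRing L v) δ -
              toLocalRing L v 2⁻¹ * (quadraticLocalEquiv L v (IsCMField.complexConj L) hcδ hδ (p 0, p 1) *
                conjLocal L (IsCMField.complexConj L) v (quadraticLocalEquiv L v (IsCMField.complexConj L) hcδ hδ (p 0, p 1)))) w') : ℝ≥0) : ℝ)))) 0 = 1 := by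
  haveI : Algebra.IsQuadraticExtension ↥(maximalRealSubfield L) L := IsCMField.isQuadraticExtension L
  refine Finset.prod_eq_one fun w' _ => ?_
  have hX : quadraticLocalEquiv L v (IsCMField.complexConj L) hcδ hδ ((0 : v.adicCompletion ↥(maximalRealSubfield L)), (0 : v.adicCompletion ↥(maximalRealSubfield L))) = 0 :=
    map_zero _
  simp only [Pi.zero_apply, hX, map_zero, zero_mul, mul_zero, sub_self, NNReal.coe_zero, max_self, max_eq_left (zero_le_one' ℝ)]

section Ball

variable [MeasurableSpace (v.adicCompletion ↥(maximalRealSubfield L))] [BorelSpace (v.adicCompletion ↥(maximalRealSubfield L))] (νv : Measure (v.adicCompletion ↥(maximalRealSubfield L))) [νv.IsAddHaarMeasure]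

/-- **THE UNIT-HEIGHT TEST BALL EXISTS AT EVERY FINITE PLACE**: there is an open `B ∋ 0`, `B ⊆ 𝒪_v³`, of positive finite `ν_v³`-volume, on which `Q_v = 1` (`B := Q_v⁻¹(−∞,2) ∩ 𝒪_v³`;
★ `continuous_localHeight`, ★ `isOpen_integralBox`∕`isCompact_integralBox`∕`zero_mem_integralBox`, §1). [cite: TateThesis1967, §3.3] [cite: MoeglinWaldspurger1995, II.1.6] -/
theorem exists_testBall :
    ∃ B : Set (Fin 3 → v.adicCompletion ↥(maximalRealSubfield L)), IsOpen B ∧ MeasurableSet B ∧ (0 : Fin 3 → v.adicCompletion ↥(maximalRealSubfield L)) ∈ B ∧ B ⊆ integralBox ↥(maximalRealSubfield L) (Fin 3) v ∧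
      (∀ p ∈ B, (∏ w' : PlacesOver L v, max 1 (max ((normAbs (w'.1.adicCompletion L) (quadraticLocalEquiv L v (IsCMField.complexConj L) hcδ hδ (p 0, p 1) w') : ℝ≥0) : ℝ)
            ((normAbs (w'.1.adicCompletion L) ((toLocalRing L v (p 2) * algebraMap L (LocalRing L v) δ -
              toLocalRing L v 2⁻¹ * (quadraticLocalEquiv L v (IsCMField.complexConj L) hcδ hδ (p 0, p 1) *
                conjLocal L (IsCMField.complexConj L) v (quadraticLocalEquiv L v (IsCMField.complexConj L) hcδ hδ (p 0, p 1)))) w') : ℝ≥0) : ℝ))) = 1) ∧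
      0 < (Measure.pi fun _ : Fin 3 => νv) B ∧ (Measure.pi fun _ : Fin 3 => νv) B < ⊤ := by
  haveI : SecondCountableTopology (v.adicCompletion ↥(maximalRealSubfield L)) := secondCountableTopology_localField _
  set B : Set (Fin 3 → v.adicCompletion ↥(maximalRealSubfield L)) := (fun p : Fin 3 → v.adicCompletion ↥(maximalRealSubfield L) => (∏ w' : PlacesOver L v, max 1 (max ((normAbs (w'.1.adicCompletion L) (quadraticLocalEquiv L v (IsCMField.complexConj L) hcδ hδ (p 0, p 1) w') : ℝ≥0) : ℝ)
            ((normAbs (w'.1.adicCompletion L) ((toLocalRing L v (p 2) * algebraMap L (LocalRing L v) δ -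
              toLocalRing L v 2⁻¹ * (quadraticLocalEquiv L v (IsCMField.complexConj L) hcδ hδ (p 0, p 1) *
                conjLocal L (IsCMField.complexConj L) v (quadraticLocalEquiv L v (IsCMField.complexConj L) hcδ hδ (p 0, p 1)))) w') : ℝ≥0) : ℝ)))) ⁻¹' Iio 2 ∩
    integralBox ↥(maximalRealSubfield L) (Fin 3) v with hB
  have hopen : IsOpen B := ((continuous_localHeight L hcδ hδ v).isOpen_preimage _ isOpen_Iio).inter (isOpen_integralBox ↥(maximalRealSubfield L) (Fin 3) v)
  have h0 : (0 : Fin 3 → v.adicCompletion ↥(maximalRealSubfield L)) ∈ B := by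
    refine ⟨?_, zero_mem_integralBox ↥(maximalRealSubfield L) (Fin 3) v⟩
    show (fun p : Fin 3 → v.adicCompletion ↥(maximalRealSubfield L) => (∏ w' : PlacesOver L v, max 1 (max ((normAbs (w'.1.adicCompletion L) (quadraticLocalEquiv L v (IsCMField.complexConj L) hcδ hδ (p 0, p 1) w') : ℝ≥0) : ℝ)
            ((normAbs (w'.1.adicCompletion L) ((toLocalRing L v (p 2) * algebraMap L (LocalRing L v) δ -
              toLocalRing L v 2⁻¹ * (quadraticLocalEquiv L v (IsCMField.complexConj L) hcδ hδ (p 0, p 1) *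
                conjLocal L (IsCMField.complexConj L) v (quadraticLocalEquiv L v (IsCMField.complexConj L) hcδ hδ (p 0, p 1)))) w') : ℝ≥0) : ℝ)))) 0 < 2
    rw [localHeight_zero L hcδ hδ v]
    norm_num
  refine ⟨B, hopen, hopen.measurableSet, h0, inter_subset_right, fun p hp => localHeight_eq_one_of_lt_two L hcδ hδ v p hp.1, hopen.measure_pos _ ⟨0, h0⟩,
    lt_of_le_of_lt (measure_mono inter_subset_right) (isCompact_integralBox ↥(maximalRealSubfield L) (Fin 3) v).measure_lt_top⟩

/-! ## §2 The χ-local mean of a test weight is a `z`-free constant, non-zero for `c ≠ 0` -/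

omit [BorelSpace (v.adicCompletion ↥(maximalRealSubfield L))] [νv.IsAddHaarMeasure] in
/-- **`m_v(z) = (ν_v³(B)∕ν_v³(𝒪_v³)) • c` FOR EVERY `z`** when the weight is `c` on `B`, `0` off `B`, and `Q_v = 1` on `B` (the integrand is `𝟙_B·c`; Mathlib `integral_indicator_const`) —
★ (a-1)'s `m_v(z)` bytes on the left. [cite: MoeglinWaldspurger1995, IV.1.11] [cite: Rogawski1990, §4.5] -/
theorem chiLocalMean_eq_of_testWeight {B : Set (Fin 3 → v.adicCompletion ↥(maximalRealSubfield L))} (hBm : MeasurableSet B)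
    (hQ : ∀ p ∈ B, (∏ w' : PlacesOver L v, max 1 (max ((normAbs (w'.1.adicCompletion L) (quadraticLocalEquiv L v (IsCMField.complexConj L) hcδ hδ (p 0, p 1) w') : ℝ≥0) : ℝ)
            ((normAbs (w'.1.adicCompletion L) ((toLocalRing L v (p 2) * algebraMap L (LocalRing L v) δ -
              toLocalRing L v 2⁻¹ * (quadraticLocalEquiv L v (IsCMField.complexConj L) hcδ hδ (p 0, p 1) *
                conjLocal L (IsCMField.complexConj L) v (quadraticLocalEquiv L v (IsCMField.complexConj L) hcδ hδ (p 0, p 1)))) w') : ℝ≥0) : ℝ))) = 1)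
    (c : ℂ) (ω : (Fin 3 → v.adicCompletion ↥(maximalRealSubfield L)) → ℂ) (hωB : ∀ p ∈ B, ω p = c) (hω0 : ∀ p ∉ B, ω p = 0) (z : ℂ) :
    ((Measure.pi fun _ : Fin 3 => νv) (integralBox ↥(maximalRealSubfield L) (Fin 3) v)).toReal⁻¹ •
        ∫ p : Fin 3 → v.adicCompletion ↥(maximalRealSubfield L),
          ω p * (((∏ w' : PlacesOver L v, max 1 (max ((normAbs (w'.1.adicCompletion L) (quadraticLocalEquiv L v (IsCMField.complexConj L) hcδ hδ (p 0, p 1) w') : ℝ≥0) : ℝ)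
            ((normAbs (w'.1.adicCompletion L) ((toLocalRing L v (p 2) * algebraMap L (LocalRing L v) δ -
              toLocalRing L v 2⁻¹ * (quadraticLocalEquiv L v (IsCMField.complexConj L) hcδ hδ (p 0, p 1) *
                conjLocal L (IsCMField.complexConj L) v (quadraticLocalEquiv L v (IsCMField.complexConj L) hcδ hδ (p 0, p 1)))) w') : ℝ≥0) : ℝ))) : ℝ) : ℂ) ^ (-z) ∂(Measure.pi fun _ : Fin 3 => νv) =
      ((((Measure.pi fun _ : Fin 3 => νv) B).toReal / ((Measure.pi fun _ : Fin 3 => νv) (integralBox ↥(maximalRealSubfield L) (Fin 3) v)).toReal : ℝ) : ℂ) * c := by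
  have hpt : ∀ p : Fin 3 → v.adicCompletion ↥(maximalRealSubfield L),
      ω p * (((∏ w' : PlacesOver L v, max 1 (max ((normAbs (w'.1.adicCompletion L) (quadraticLocalEquiv L v (IsCMField.complexConj L) hcδ hδ (p 0, p 1) w') : ℝ≥0) : ℝ)
            ((normAbs (w'.1.adicCompletion L) ((toLocalRing L v (p 2) * algebraMap L (LocalRing L v) δ -
              toLocalRing L v 2⁻¹ * (quadraticLocalEquiv L v (IsCMField.complexConj L) hcδ hδ (p 0, p 1) *
                conjLocal L (IsCMField.complexConj L) v (quadraticLocalEquiv L v (IsCMField.complexConj L) hcδ hδ (p 0, p 1)))) w') : ℝ≥0) : ℝ))) : ℝ) : ℂ) ^ (-z) = B.indicator (fun _ => c) p := fun p => by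
    by_cases hp : p ∈ B
    · rw [indicator_of_mem hp, hωB p hp, hQ p hp, Complex.ofReal_one, Complex.one_cpow, mul_one]
    · rw [indicator_of_notMem hp, hω0 p hp, zero_mul]
  rw [integral_congr_ae (Eventually.of_forall hpt), integral_indicator_const c hBm, Complex.real_smul, Measure.real, Complex.real_smul, ← mul_assoc,
    ← Complex.ofReal_mul, div_eq_inv_mul]

omit [BorelSpace (v.adicCompletion ↥(maximalRealSubfield L))] in
/-- **`m_v(z) ≠ 0` FOR EVERY `z`** for a test weight with `c ≠ 0` on a set `B` of positive finite volume with `Q_v = 1` — in particular at `z = 3∕2`: the finite half of ★ F5's `hA32`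
for ★ (a-2b)'s amplitude, place by place. [cite: MoeglinWaldspurger1995, IV.1.11] [cite: Rogawski1990, §4.5] -/
theorem chiLocalMean_ne_zero_of_testWeight {B : Set (Fin 3 → v.adicCompletion ↥(maximalRealSubfield L))} (hBm : MeasurableSet B)
    (hBpos : 0 < (Measure.pi fun _ : Fin 3 => νv) B) (hBfin : (Measure.pi fun _ : Fin 3 => νv) B < ⊤)
    (hQ : ∀ p ∈ B, (∏ w' : PlacesOver L v, max 1 (max ((normAbs (w'.1.adicCompletion L) (quadraticLocalEquiv L v (IsCMField.complexConj L) hcδ hδ (p 0, p 1) w') : ℝ≥0) : ℝ)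
            ((normAbs (w'.1.adicCompletion L) ((toLocalRing L v (p 2) * algebraMap L (LocalRing L v) δ -
              toLocalRing L v 2⁻¹ * (quadraticLocalEquiv L v (IsCMField.complexConj L) hcδ hδ (p 0, p 1) *
                conjLocal L (IsCMField.complexConj L) v (quadraticLocalEquiv L v (IsCMField.complexConj L) hcδ hδ (p 0, p 1)))) w') : ℝ≥0) : ℝ))) = 1)
    {c : ℂ} (hc : c ≠ 0) (ω : (Fin 3 → v.adicCompletion ↥(maximalRealSubfield L)) → ℂ) (hωB : ∀ p ∈ B, ω p = c) (hω0 : ∀ p ∉ B, ω p = 0) (z : ℂ) :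
    ((Measure.pi fun _ : Fin 3 => νv) (integralBox ↥(maximalRealSubfield L) (Fin 3) v)).toReal⁻¹ •
        ∫ p : Fin 3 → v.adicCompletion ↥(maximalRealSubfield L),
          ω p * (((∏ w' : PlacesOver L v, max 1 (max ((normAbs (w'.1.adicCompletion L) (quadraticLocalEquiv L v (IsCMField.complexConj L) hcδ hδ (p 0, p 1) w') : ℝ≥0) : ℝ)
            ((normAbs (w'.1.adicCompletion L) ((toLocalRing L v (p 2) * algebraMap L (LocalRing L v) δ -
              toLocalRing L v 2⁻¹ * (quadraticLocalEquiv L v (IsCMField.complexConj L) hcδ hδ (p 0, p 1) *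
                conjLocal L (IsCMField.complexConj L) v (quadraticLocalEquiv L v (IsCMField.complexConj L) hcδ hδ (p 0, p 1)))) w') : ℝ≥0) : ℝ))) : ℝ) : ℂ) ^ (-z) ∂(Measure.pi fun _ : Fin 3 => νv) ≠ 0 := by
  haveI : SecondCountableTopology (v.adicCompletion ↥(maximalRealSubfield L)) := secondCountableTopology_localField _
  rw [chiLocalMean_eq_of_testWeight L hcδ hδ v νv hBm hQ c ω hωB hω0 z]
  refine mul_ne_zero ?_ hc
  have hB : 0 < ((Measure.pi fun _ : Fin 3 => νv) B).toReal := ENNReal.toReal_pos hBpos.ne' hBfin.ne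
  have hbox : 0 < ((Measure.pi fun _ : Fin 3 => νv) (integralBox ↥(maximalRealSubfield L) (Fin 3) v)).toReal :=
    ENNReal.toReal_pos ((isOpen_integralBox ↥(maximalRealSubfield L) (Fin 3) v).measure_pos _ ⟨0, zero_mem_integralBox ↥(maximalRealSubfield L) (Fin 3) v⟩).ne'
      (isCompact_integralBox ↥(maximalRealSubfield L) (Fin 3) v).measure_lt_top.ne
  exact_mod_cast (div_pos hB hbox).ne'

omit [IsCMField L] [BorelSpace (v.adicCompletion ↥(maximalRealSubfield L))] [νv.IsAddHaarMeasure] in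
/-- The test weight `𝟙_B·c` is a.e.-strongly measurable (★ (a-3)'s hypothesis `hω`). [folklore] -/
theorem aestronglyMeasurable_testWeight {B : Set (Fin 3 → v.adicCompletion ↥(maximalRealSubfield L))} (hBm : MeasurableSet B) (c : ℂ)
    (ω : (Fin 3 → v.adicCompletion ↥(maximalRealSubfield L)) → ℂ) (hωB : ∀ p ∈ B, ω p = c) (hω0 : ∀ p ∉ B, ω p = 0) :
    AEStronglyMeasurable ω (Measure.pi fun _ : Fin 3 => νv) := by
  have hω : ω = B.indicator fun _ => c := by
    funext p
    by_cases hp : p ∈ B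
    · rw [indicator_of_mem hp, hωB p hp]
    · rw [indicator_of_notMem hp, hω0 p hp]
  rw [hω]
  exact (aestronglyMeasurable_const.indicator hBm)

omit [IsCMField L] [MeasurableSpace (v.adicCompletion ↥(maximalRealSubfield L))] [BorelSpace (v.adicCompletion ↥(maximalRealSubfield L))] in
/-- The test weight has modulus `≤ 1` when `‖c‖ ≤ 1` (★ (a-3)'s hypothesis `hωb`). [folklore] -/
theorem norm_testWeight_le {B : Set (Fin 3 → v.adicCompletion ↥(maximalRealSubfield L))} {c : ℂ} (hc : ‖c‖ ≤ 1)
    (ω : (Fin 3 → v.adicCompletion ↥(maximalRealSubfield L)) → ℂ) (hωB : ∀ p ∈ B, ω p = c) (hω0 : ∀ p ∉ B, ω p = 0) (p : Fin 3 → v.adicCompletion ↥(maximalRealSubfield L)) :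
    ‖ω p‖ ≤ 1 := by
  by_cases hp : p ∈ B
  · rw [hωB p hp]; exact hc
  · rw [hω0 p hp, norm_zero]; exact zero_le_one

end Ball

end Summit.HodgeConjecture.HodgeConjecture.Cruxes.H413.K2E1ChiLocalMeanTestWeightU3

end
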